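import Summits.CriticalPhenomena.SAWScalingLimit.Theorems.SAWLoopFugacityFlowIsingBoundaryRatioRoughHalfAnnulusRSW
import HarnessLib

/-!
# Rough half-annulus RSW, PATH form: the boundary-condition / far-graph reduction
(line `fk-anchor-transfer`, crux `IsingBoundaryRatio`, stmt-CriticalPhenomena-10650)

Companion of `…IsingBoundaryRatioRoughHalfAnnulusRSW.lean`: the guarded path separation event `AnnPathSepG`
(an `ω`-open walk inside the annulus meeting every walk from `In` to the outside, required only when such a
walk exists) is increasing, determined by the edges touching the annulus, and blind to the graph off the
sites of `In ∪ Ann`; hence `roughHalfAnnulusRSWPath_of_pathMesh : RoughHalfAnnulusRSWMeshOf AnnPathSepG →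
RoughHalfAnnulusRSWOf AnnPathSepG` by the generic reduction `roughHalfAnnulusRSWOf_of_meshOf`. Also:
`annSep_of_annPathSep` (the path form implies the set form, `S` = the support).
-/

noncomputable section

open scoped Classical Topology
open Filter Set Metric SimpleGraph
open Literature.Probability.LatticeModels Literature.Probability.RandomPlanarGeometry
open Literature.Probability.Percolation (BondConfig openConnIn openGraph)

namespace Summit.CriticalPhenomena.SAWScalingLimit.Theorems.IsingBoundaryRatio

variable {Λ : Finset (Site 2)}

/-- `AnnPathSep` is increasing in the configuration. [folklore] -/
theorem annPathSep_mono {H : SimpleGraph Λ} {In Ann : Set Λ} {ω ω' : BondConfig Λ} (h : ω ⊆ ω')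
    (hω : AnnPathSep H In Ann ω) : AnnPathSep H In Ann ω' := by
  obtain ⟨u, v, p, hsupp, hopen, hcut⟩ := hω
  exact ⟨u, v, p, hsupp, fun e he => h (hopen e he), hcut⟩

/-- The guarded path separation event is increasing. [folklore] -/
theorem isUpperSet_annPathSepG (H : SimpleGraph Λ) (In Ann : Set Λ) :
    IsUpperSet {ω : BondConfig Λ | AnnPathSepG H In Ann ω} :=
  fun _ _ h hω hl => annPathSep_mono h (hω hl)

/-- `AnnPathSep` is determined by the edges touching the annulus (its open walk lives inside `Ann`).
[folklore] -/
theorem annPathSep_inter_annEdgeFinset_iff {H : SimpleGraph Λ} {In Ann : Set Λ} {ω : BondConfig Λ} :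
    AnnPathSep H In Ann (ω ∩ ↑(annEdgeFinset H Ann)) ↔ AnnPathSep H In Ann ω := by
  refine ⟨annPathSep_mono inter_subset_left, fun ⟨u, v, p, hsupp, hopen, hcut⟩ =>
    ⟨u, v, p, hsupp, fun e he => ⟨hopen e he, ?_⟩, hcut⟩⟩
  rw [Finset.mem_coe, mem_annEdgeFinset]
  refine ⟨p.edges_subset_edgeSet he, ?_⟩
  revert he
  refine Sym2.ind (fun x y he => ?_) e
  exact ⟨x, hsupp x (p.fst_mem_support_of_mem_edges he), Sym2.mem_mk_left x y⟩

/-- The guarded path separation event is determined by the edges touching the annulus. [folklore] -/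
theorem annPathSepG_inter_annEdgeFinset_iff {H : SimpleGraph Λ} {In Ann : Set Λ} {ω : BondConfig Λ} :
    AnnPathSepG H In Ann (ω ∩ ↑(annEdgeFinset H Ann)) ↔ AnnPathSepG H In Ann ω :=
  imp_congr_right fun _ => annPathSep_inter_annEdgeFinset_iff

/-- The link guard only sees the edges at the sites of `In ∪ Ann` (prefix up to the first exit). [folklore] -/
theorem annLink_of_agree {H H' : SimpleGraph Λ} {In Ann : Set Λ}
    (hag : ∀ u ∈ In ∪ Ann, ∀ v, H.Adj u v ↔ H'.Adj u v) (h : AnnLink H In Ann) : AnnLink H' In Ann := by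
  obtain ⟨a, b, q, ha, hb⟩ := h
  obtain ⟨w, q₁, hw, hd, -⟩ := exists_prefix_darts (fun z => z ∈ In ∪ Ann) q hb
  obtain ⟨q', -, -⟩ := exists_walk_of_darts (G' := H') q₁ fun d hdq => (hag _ (hd d hdq) _).1 d.adj
  exact ⟨a, w, q', ha, hw⟩

/-- `AnnPathSep` only sees the edges at the sites of `In ∪ Ann`: the open walk inside `Ann` transfers, and
a walk from `In` to the outside is cut at its first exit from `In ∪ Ann`. [folklore] -/
theorem annPathSep_of_agree {H H' : SimpleGraph Λ} {In Ann : Set Λ}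
    (hag : ∀ u ∈ In ∪ Ann, ∀ v, H.Adj u v ↔ H'.Adj u v) {ω : BondConfig Λ}
    (h : AnnPathSep H' In Ann ω) : AnnPathSep H In Ann ω := by
  obtain ⟨u, v, p, hsupp, hopen, hcut⟩ := h
  obtain ⟨p', hp's, hp'e⟩ := exists_walk_of_darts (G' := H) p fun d hd =>
    (hag _ (Or.inr (hsupp _ (p.dart_fst_mem_support_of_mem_darts hd))) _).2 d.adj
  refine ⟨u, v, p', fun z hz => hsupp z (hp's ▸ hz), fun e he => hopen e (hp'e ▸ he),
    fun a b ha hb q => ?_⟩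
  obtain ⟨w, q₁, hw, hd, hs⟩ := exists_prefix_darts (fun z => z ∈ In ∪ Ann) q hb
  obtain ⟨q₁', hq₁'s, -⟩ := exists_walk_of_darts (G' := H') q₁ fun d hdq => (hag _ (hd d hdq) _).1 d.adj
  obtain ⟨z, hz, hzp⟩ := hcut a w ha hw q₁'
  exact ⟨z, hs (hq₁'s ▸ hz), by rw [hp's]; exact hzp⟩

/-- The guarded path separation event is blind to the graph off the sites of `In ∪ Ann`. [folklore] -/
theorem annPathSepG_iff_of_agree {H H' : SimpleGraph Λ} {In Ann : Set Λ}
    (hag : ∀ u ∈ In ∪ Ann, ∀ v, H.Adj u v ↔ H'.Adj u v) (ω : BondConfig Λ) :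
    AnnPathSepG H In Ann ω ↔ AnnPathSepG H' In Ann ω :=
  have hag' : ∀ u ∈ In ∪ Ann, ∀ v, H'.Adj u v ↔ H.Adj u v := fun u hu v => (hag u hu v).symm
  ⟨fun h hl => annPathSep_of_agree hag' (h (annLink_of_agree hag' hl)),
    fun h hl => annPathSep_of_agree hag (h (annLink_of_agree hag hl))⟩

/-- Along an `ω`-open walk inside `Ann`, every vertex of the support is joined to the start by an open path
inside `Ann`. [folklore] -/
theorem openConnIn_of_walk {H : SimpleGraph Λ} {Ann : Set Λ} {ω : BondConfig Λ} {u v : Λ} (p : H.Walk u v)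
    (hsupp : ∀ z ∈ p.support, z ∈ Ann) (hopen : ∀ e ∈ p.edges, e ∈ ω) :
    ∀ z ∈ p.support, ω ∈ openConnIn Ann u z := by
  induction p with
  | nil =>
    intro z hz
    rw [Walk.support_nil, List.mem_singleton] at hz
    subst hz
    exact ⟨hsupp _ (by simp), hsupp _ (by simp), Reachable.refl _⟩
  | @cons a b c hab p' ih =>
    intro z hz
    have ha : a ∈ Ann := hsupp a (by simp)
    rw [Walk.support_cons, List.mem_cons] at hz
    rcases hz with rfl | hz
    · exact ⟨ha, ha, Reachable.refl _⟩
    · obtain ⟨hb, hz', hr⟩ :=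
        ih (fun z hz => hsupp z (by simp [hz])) (fun e he => hopen e (by simp [he])) z hz
      refine ⟨ha, hz', Reachable.trans (Adj.reachable ?_) hr⟩
      simp only [comap_adj, Function.Embedding.coe_subtype, Literature.Probability.Percolation.openGraph_adj]
      exact ⟨hopen _ (by simp), hab.ne⟩

/-- **The path form implies the set form**: the support of the open walk is a separating set pairwise
open-connected inside the annulus. [folklore] -/
theorem annSep_of_annPathSep {H : SimpleGraph Λ} {In Ann : Set Λ} {ω : BondConfig Λ}
    (h : AnnPathSep H In Ann ω) : AnnSep H In Ann ω := by
  obtain ⟨u, v, p, hsupp, hopen, hcut⟩ := h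
  refine ⟨{z | z ∈ p.support}, fun z hz => hsupp z hz, fun x hx y hy => ?_, fun a b ha hb q => hcut a b ha hb q⟩
  obtain ⟨hu, hx', hrx⟩ := openConnIn_of_walk p hsupp hopen x hx
  obtain ⟨hu', hy', hry⟩ := openConnIn_of_walk p hsupp hopen y hy
  exact ⟨hx', hy', hrx.symm.trans hry⟩

/-- **The reduction for the path form** (`Sep = AnnPathSepG`): the mesh-graph form with extremal boundary
conditions implies the conditional-cylinder form. [cite: Grimmett2006, Lemma (4.13) and Lemma (4.14)(b)] -/
theorem roughHalfAnnulusRSWPath_of_pathMesh :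
    RoughHalfAnnulusRSWMeshOf AnnPathSepG → RoughHalfAnnulusRSWOf AnnPathSepG :=
  fun h => roughHalfAnnulusRSWOf_of_meshOf AnnPathSepG isUpperSet_annPathSepG
    (fun _ _ _ _ _ => annPathSepG_inter_annEdgeFinset_iff) (fun hag ω => annPathSepG_iff_of_agree hag ω) h

end Summit.CriticalPhenomena.SAWScalingLimit.Theorems.IsingBoundaryRatio

end
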